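import Mathlib.RingTheory.Regular.RegularSequence
import Mathlib.RingTheory.KrullDimension.Basic
import Mathlib.RingTheory.Filtration
import Mathlib.RingTheory.LocalRing.RingHom.Basic
import Literature.RingTheory.TightClosure.TightClosure
import HarnessLib

/-!
# Initial segments of a system of parameters (crux `FrobeniusLadder.FInjectiveMacaulayfication`, line `Sketch`)

Helper stub `stub_partialSop` of the skeleton `Sketch` for crux stmt-ResolutionOfSingularities-15315
(route `FrobeniusLadder`, rung 2; cycle-4 "degree-zero descent" toolbox).  Let `(R, 𝔪)` be a
Noetherian local ring of prime characteristic `p` satisfying the crux's clause in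
`IsSystemOfParameters` form: every system of parameters `u` (`dim R` elements with `rad (u) = 𝔪`)
is a weakly regular sequence and generates a Frobenius closed ideal.  Then every INITIAL SEGMENT `s`
of a system of parameters `Fin.append s t` is again a weakly regular sequence and generates a
Frobenius closed ideal.

Proof.  Weak regularity of a prefix is immediate: `List.ofFn (Fin.append s t) = List.ofFn s ++
List.ofFn t` (`List.ofFn_fin_append`) and `RingTheory.Sequence.isWeaklyRegular_append_iff`.
Frobenius-closedness: put `I = (s)`.  For `n ≥ 1` the tuple `(s, tⁿ)` (componentwise `n`-th powers
of the tail) is again a system of parameters (same radical `𝔪`), so `J_n = (s, tⁿ)` is Frobenius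
closed by hypothesis and `I^F ⊆ J_n^F = J_n ⊆ I + 𝔪ⁿ`.  Hence `I^F ⊆ ⋂ₙ (I + 𝔪ⁿ) = I` by Krull's
intersection theorem in the Noetherian local ring `R/I` — verbatim the argument of the tight-closure
twin `FRationalResolution.isTightlyClosed_span_image_Iio_of_isFRational`
(`Theorems/FrobeniusLadderFRationalResolutionPartialSopTightlyClosed.lean`), with tight closure
replaced by Frobenius closure and the split index `i` replaced by `Fin.append`.  No named facts.

## References

* [QuyShimomoto2017] P. H. Quy, K. Shimomoto, *F-injectivity and Frobenius closure of ideals in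
  Noetherian rings of characteristic p > 0*, Adv. Math. 313 (2017) 127–166, §3 (parameter ideals
  in F-injective rings).
* [HochsterHuneke1994] M. Hochster, C. Huneke, *F-regularity, test elements, and smooth base change*,
  Trans. Amer. Math. Soc. 346 (1994) 1–62, Thm. 4.2 (c) (proof) — the tight-closure original.
-/

-- single-problem summit: the doubled namespace component is forced
set_option linter.dupNamespace false

open Literature.RingTheory.TightClosure IsLocalRing

namespace Summit.ResolutionOfSingularities.ResolutionOfSingularities.Theorems.FInjectiveMacaulayfication.PartialSop

/-- **The ideal of an initial segment of a system of parameters is Frobenius closed** (in a Noetherian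
local ring of prime characteristic `p` all of whose parameter ideals are Frobenius closed and all of
whose systems of parameters are weakly regular).  If `Fin.append s t` is a system of parameters, then
`(s)^F ⊆ ⋂ₙ (s, tⁿ) ⊆ ⋂ₙ ((s) + 𝔪ⁿ) = (s)`: each `(s, tⁿ)`, `n ≥ 1`, is again a parameter ideal,
hence Frobenius closed, and the last equality is Krull's intersection theorem in `R/(s)` (the
Frobenius-closure twin of Hochster–Huneke 1994, Thm. 4.2 (c); cf. Quy–Shimomoto 2017, §3).
[folklore] -/
theorem isFrobeniusClosed_span_range_of_append (p : ℕ) [Fact p.Prime] (R : Type) [CommRing R]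
    [IsNoetherianRing R] [IsLocalRing R] [CharP R p]
    (hR : ∀ ⦃n : ℕ⦄ (u : Fin n → R), IsSystemOfParameters u →
        RingTheory.Sequence.IsWeaklyRegular R (List.ofFn u) ∧
          IsFrobeniusClosed p (Ideal.span (Set.range u)))
    {d e : ℕ} (s : Fin d → R) (t : Fin e → R) (hst : IsSystemOfParameters (Fin.append s t)) :
    IsFrobeniusClosed p (Ideal.span (Set.range s)) := by
  obtain ⟨hd, hrad⟩ := hst
  -- every parameter lies in `𝔪 = rad (s, t)`
  have hsm : ∀ i, s i ∈ maximalIdeal R := fun i => by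
    rw [← hrad]
    exact Ideal.le_radical (Ideal.subset_span ⟨Fin.castAdd e i, Fin.append_left s t i⟩)
  have htm : ∀ j, t j ∈ maximalIdeal R := fun j => by
    rw [← hrad]
    exact Ideal.le_radical (Ideal.subset_span ⟨Fin.natAdd d j, Fin.append_right s t j⟩)
  set I : Ideal R := Ideal.span (Set.range s)
  have hIm : I ≤ maximalIdeal R := by
    refine Ideal.span_le.mpr ?_
    rintro _ ⟨i, rfl⟩
    exact hsm i
  rw [isFrobeniusClosed_iff_le]
  intro y hy
  -- `y ∈ I + 𝔪ⁿ` for every `n ≥ 1`, via the system of parameters `(s, tⁿ)`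
  have hyn : ∀ n : ℕ, 0 < n → y ∈ I ⊔ maximalIdeal R ^ n := by
    intro n hn
    -- the modified system of parameters
    let s' : Fin (d + e) → R := Fin.append s fun j => t j ^ n
    have hs'_left : ∀ i, s' (Fin.castAdd e i) = s i := fun i => Fin.append_left _ _ i
    have hs'_right : ∀ j, s' (Fin.natAdd d j) = t j ^ n := fun j => Fin.append_right _ _ j
    set J : Ideal R := Ideal.span (Set.range s')
    have hsop : IsSystemOfParameters s' := by
      refine ⟨hd, le_antisymm ?_ ?_⟩
      · -- `rad J ≤ 𝔪` since `J ≤ 𝔪`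
        refine (maximalIdeal.isMaximal R).isPrime.radical_le_iff.mpr (Ideal.span_le.mpr ?_)
        rintro _ ⟨i, rfl⟩
        induction i using Fin.addCases with
        | left i =>
          rw [hs'_left]
          exact hsm i
        | right j =>
          rw [hs'_right]
          exact Ideal.pow_mem_of_mem _ (htm j) n hn
      · -- `𝔪 = rad (s, t) ≤ rad J` since `(s, t) ≤ rad J`
        rw [← hrad]
        refine Ideal.radical_le_radical_iff.mpr (Ideal.span_le.mpr ?_)
        rintro _ ⟨i, rfl⟩
        induction i using Fin.addCases with
        | left i =>
          rw [Fin.append_left]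
          exact Ideal.le_radical (Ideal.subset_span ⟨Fin.castAdd e i, hs'_left i⟩)
        | right j =>
          rw [Fin.append_right]
          exact ⟨n, Ideal.subset_span ⟨Fin.natAdd d j, hs'_right j⟩⟩
    have hJ' : IsFrobeniusClosed p J := (hR s' hsop).2
    have hIJ : I ≤ J := by
      refine Ideal.span_le.mpr ?_
      rintro _ ⟨i, rfl⟩
      exact Ideal.subset_span ⟨Fin.castAdd e i, hs'_left i⟩
    have hyJ : y ∈ J := hJ'.le (frobeniusClosure_mono p hIJ hy)
    refine (Ideal.span_le.mpr ?_ : J ≤ I ⊔ maximalIdeal R ^ n) hyJ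
    rintro _ ⟨i, rfl⟩
    induction i using Fin.addCases with
    | left i =>
      rw [hs'_left]
      exact Ideal.mem_sup_left (Ideal.subset_span ⟨i, rfl⟩)
    | right j =>
      rw [hs'_right]
      exact Ideal.mem_sup_right (Ideal.pow_mem_pow (htm j) n)
  -- Krull's intersection theorem in `R/I`
  have hItop : I ≠ ⊤ := fun h => (maximalIdeal.isMaximal R).ne_top (top_le_iff.mp (h ▸ hIm))
  haveI : Nontrivial (R ⧸ I) := Ideal.Quotient.nontrivial_iff.mpr hItop
  haveI : IsLocalRing (R ⧸ I) :=
    IsLocalRing.of_surjective' (Ideal.Quotient.mk I) Ideal.Quotient.mk_surjective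
  have hmk : (maximalIdeal R).map (Ideal.Quotient.mk I) = maximalIdeal (R ⧸ I) :=
    IsLocalRing.map_maximalIdeal_of_surjective _ Ideal.Quotient.mk_surjective
  have hbar : Ideal.Quotient.mk I y ∈ ⨅ n : ℕ, maximalIdeal (R ⧸ I) ^ n := by
    refine Ideal.mem_iInf.mpr fun n => ?_
    rcases Nat.eq_zero_or_pos n with rfl | hn
    · rw [pow_zero, Ideal.one_eq_top]
      trivial
    have := Ideal.mem_map_of_mem (Ideal.Quotient.mk I) (hyn n hn)
    rw [Ideal.map_sup, Ideal.map_quotient_self, bot_sup_eq, Ideal.map_pow, hmk] at this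
    exact this
  rw [Ideal.iInf_pow_eq_bot_of_isLocalRing _ (maximalIdeal.isMaximal (R ⧸ I)).ne_top,
    Ideal.mem_bot, Ideal.Quotient.eq_zero_iff_mem] at hbar
  exact hbar

/-- **Initial segments of a system of parameters** (helper stub `stub_partialSop`, cycle 4): in a
Noetherian local ring of prime characteristic `p` in which every system of parameters is a weakly
regular sequence generating a Frobenius closed ideal, every initial segment `s` of a system of
parameters `Fin.append s t` is weakly regular (`List.ofFn_fin_append`,
`RingTheory.Sequence.isWeaklyRegular_append_iff`) and generates a Frobenius closed ideal
(`isFrobeniusClosed_span_range_of_append`: `(s) = ⋂ₙ (s, tⁿ)` by Krull's intersection theorem in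
`R/(s)`). [folklore] -/
theorem stub_partialSop : ∀ (p : ℕ) [Fact p.Prime] (R : Type) [CommRing R] [IsNoetherianRing R]
    [IsLocalRing R] [CharP R p],
    (∀ ⦃n : ℕ⦄ (u : Fin n → R), Literature.RingTheory.TightClosure.IsSystemOfParameters u →
        RingTheory.Sequence.IsWeaklyRegular R (List.ofFn u) ∧
        Literature.RingTheory.TightClosure.IsFrobeniusClosed p (Ideal.span (Set.range u))) →
    ∀ (d e : ℕ) (s : Fin d → R) (t : Fin e → R),
      Literature.RingTheory.TightClosure.IsSystemOfParameters (Fin.append s t) →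
      RingTheory.Sequence.IsWeaklyRegular R (List.ofFn s) ∧
        Literature.RingTheory.TightClosure.IsFrobeniusClosed p (Ideal.span (Set.range s)) := by
  intro p _ R _ _ _ _ hR d e s t hst
  refine ⟨?_, isFrobeniusClosed_span_range_of_append p R hR s t hst⟩
  -- weak regularity of a prefix of a weakly regular sequence
  have hreg := (hR _ hst).1
  rw [List.ofFn_fin_append] at hreg
  exact ((RingTheory.Sequence.isWeaklyRegular_append_iff R (List.ofFn s) (List.ofFn t)).mp hreg).1

end Summit.ResolutionOfSingularities.ResolutionOfSingularities.Theorems.FInjectiveMacaulayfication.PartialSop
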